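import Mathlib
import HarnessLib
import Summits.HubbardSuperconductivity.HubbardSuperconductivity.Theorems.KLProgrammeKLRegimeSectorSlicePairWtFatIncr
import Summits.HubbardSuperconductivity.HubbardSuperconductivity.Theorems.KLProgrammeKLRegimeSectorSlicePairFamIncrScaleSectional
import Summits.HubbardSuperconductivity.HubbardSuperconductivity.Theorems.KLProgrammeKLRegimeSectorSliceFatSections

/-!
# K3 VL child `KLRegimeVolumeLimitV17F2` (stmt-HubbardSuperconductivity-20440), located item #23 «W2-HALF-VL» / «W2H-SEC-FAM», brick 2: the per-pair
# SECTIONAL (fixed-time, spatially weighted) bound for the fat INCREMENT pair `(F̃^{K_o}_ω − F̃^K_ω)·F̃^K_{ω′}` against the slice band on `K_b` — ε-FREE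

Cell `gate-hubbard-kl`, seat p3 (g13), lead of #23.  The fixed-time twin of k3c3-p2's D5c `slicePairWt_bgmFatIncr_le` (`…SectorSlicePairWtFatIncr`,
p596066): SAME section variables and data (k3c3-p2's `norm_fwdDiff_iter_fatIncrPair_scaleIso_le` / `…scaleTan_le` / `bgmFatIncrPair_ampTime_data`), SAME
eleven spatial thresholds, NO time condition; the core is brick 1 `slicePairWt_charSum_sectional_le_famIncrScale` (p3 g13) and the support count is
replaced by the two SECTION counts of the co-factor `F̃^K_{ω′}` (p3 g11 `card_timeSections_bgmFat_le`, `card_spaceSection_bgmFat_le` — the increment pair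
vanishes where `F̃^K_{ω′}` does).  Result, for EVERY time difference `z₁`:
`Σ_{z₂} (1 + (ρ/x)|z̃₂|₁)·‖Σ_q χχ • (βL²)⁻²(Gs^Δ·Ψ̂^{K_b})(q)‖ ≤ (Λ_mβ/π + 3)·(x·√(524288(1/s₀+1)[…])·√(24·L²·N̄_cell)·(𝔅₀(x)·(βL²)⁻²·4βL²/Λ))` —
no `2M`: the ε-free fixed-time input `T₁`/`T₂` of `secRowWt_sliceCT_familySub_le_of_pairBounds` (p603596, `…TowerStepCovSectionalPieces` §4) for the
sectional FAMILY piece of the #23 telescope (`scaleCovSecData_klStepCov_of_frame_telescope.hFsec`), after `secWt_tnorm_le_of_rateWt`.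

* **`slicePairWt_bgmFatIncr_sectional_le`**.

Everything is proved; no definitions; nothing asserts any stub, K3, VL or superconductivity. [cite: BenfattoGiulianiMastropietro2006, §2.8 (2.81), §3 (3.2)–(3.8)]
-/

noncomputable section

namespace Summit.HubbardSuperconductivity.HubbardSuperconductivity.Theorems.TorusFourierL2

set_option linter.dupNamespace false -- summit = problem name (single-conjunct summit), D-0017

open Set Finset Filter Topology Literature.MathematicalPhysics.QuantumLattice Literature.MathematicalPhysics.QuantumLattice.BandSectorCounting
open Literature.MathematicalPhysics.QuantumLattice.FermiRG Literature.Probability.LatticeModels Literature.Analysis.SpecialFunctions Literature.Analysis.Calculus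
open Summit.HubbardSuperconductivity.HubbardSuperconductivity.Theorems.DispersionFlow
open Summit.HubbardSuperconductivity.HubbardSuperconductivity.Theorems.KLRegimeSplit
open Summit.HubbardSuperconductivity.HubbardSuperconductivity.Theorems.KLProgrammeLegKernels
open Summit.HubbardSuperconductivity.HubbardSuperconductivity.Theorems.PerturbedFermiCurve
open scoped Real Nat

section PairBound

open Classical

variable {L M : ℕ} [NeZero L] [NeZero M] {a b : ℝ} (B : BandBounds a b) {K : TrigPolyC4v} (Ko Kb : TrigPolyC4v) {A A₃ : ℝ}
  (hA : ∀ p : Momentum, ∀ j ≤ 2, ‖iteratedFDeriv ℝ j (frameShift K) p‖ ≤ A) (hA3 : ∀ p : Momentum, ‖iteratedFDeriv ℝ 3 (frameShift K) p‖ ≤ A₃)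
  (hADt : 2 * A < B.Dtmin)
  {μ e₀ z β : ℝ} (he : 0 < e₀) (hz : 0 < z) (hz1 : z ≤ 1) (hgap : e₀ + A + z ^ 2 < -μ) (h3 : e₀ + A - μ ≤ 3)
  (hlo : a ≤ μ - A - e₀) (hhi : μ + A + e₀ ≤ b) (hβ : 0 < β) (hρA : 4 * A < 2 * B.rhomin)
  (m : ℕ) (hMm : klScale e₀ m * β < π * (2 * M - 5))
  {d : ℝ} (hd : 0 ≤ d) (hd1 : ∀ u, |deriv (bgmCutoffSq e₀) u| ≤ d) (hd2 : ∀ u, |iteratedDeriv 2 (bgmCutoffSq e₀) u| ≤ d)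
  (hd3 : ∀ u, |iteratedDeriv 3 (bgmCutoffSq e₀) u| ≤ d) (hd4 : ∀ u, |iteratedDeriv 4 (bgmCutoffSq e₀) u| ≤ d)
  {Ba : ℝ} (hB0 : 0 ≤ Ba)
  (hB : ∀ (i : ℕ), i ≤ 3 → ∀ (n : ℕ) (ω : ℤ) (θ₀ : ℝ) (q w : Fin 2 → ℝ) (t : ℝ) {r₀ : ℝ}, 0 < r₀ →
    r₀ ≤ ‖momToComplex (q + t • w)‖ → |sectorRelAngle θ₀ (q + t • w)| < π →
    ‖iteratedDeriv i (fun t : ℝ => sectorWeightCirc n ω (polarAngle (q + t • w))) t‖ ≤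
      (3 : ℕ)! * Ba * ((1 + (sectorWidth n)⁻¹ * (3 : ℕ)!) * ‖momToComplex w‖ / r₀) ^ i)
  {K₂ : ℝ} (hK₂ : ∀ p, ‖iteratedFDeriv ℝ 2 (frameLevel μ K) p‖ ≤ K₂)
  {Nr : ℝ} (hNr : 2 ≤ Nr) (hLz : 3 * |2 * π / L| * (Nr + 1 / 2) ≤ z)
  -- the piece `ν = e_K − e_{K_o}` in the two-scale class at depth `x`
  {ν : (Fin 2 → ℝ) → ℝ} (hν : ∀ p, ν p = frameLevel μ K (WithLp.toLp 2 p) - frameLevel μ Ko (WithLp.toLp 2 p)) (hνs : ContDiff ℝ 3 ν)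
  {x G₀ G₁ G₂ G₃ ε₃₀ ε₃₁ : ℝ} (hx : 1 ≤ x) (hG₀ : 0 < G₀) (hG₁ : 0 ≤ G₁) (hG₂ : 0 ≤ G₂) (hG₃ : 0 ≤ G₃) (hε₃₀ : 0 ≤ ε₃₀) (hε₃₁ : 0 ≤ ε₃₁)
  (hN₀ : ∀ p, |ν p| ≤ G₀ / x ^ 2) (hN₁ : ∀ p, ‖fderiv ℝ ν p‖ ≤ G₁ / x) (hN₂ : ∀ p, ‖iteratedFDeriv ℝ 2 ν p‖ ≤ G₂)
  (hN₃ : ∀ p, ‖iteratedFDeriv ℝ 3 ν p‖ ≤ G₃ * x) (hGΛ : G₀ / x ^ 2 ≤ klScale e₀ m) (hA₃x : 4 + 8 * A₃ ≤ ε₃₀ + ε₃₁ * x)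
  -- the band frame `K_b`: slice, jets in the class, cutoff, tangency transfer
  {Λ Λ' : ℝ} (hΛ : 0 < Λ) (hΛΛ' : Λ ≤ Λ')
  {Kb₁ Kb₂ Kb₃ : ℝ} (hKb₁ : ∀ p, ‖fderiv ℝ (frameLevel μ Kb) p‖ ≤ Kb₁) (hKb₂ : ∀ p, ‖iteratedFDeriv ℝ 2 (frameLevel μ Kb) p‖ ≤ Kb₂)
  (hKb₃ : ∀ p, ‖iteratedFDeriv ℝ 3 (frameLevel μ Kb) p‖ ≤ Kb₃)
  {bs b₂ b₂' b₃ b₃' : ℝ} (hbs : 0 ≤ bs) (hKb₁b : Kb₁ ≤ bs) (hKb₂x : Kb₂ ≤ b₂ + b₂' * x) (hKb₃x : Kb₃ ≤ b₃ + b₃' * x)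
  {B₁ B₂ B₃ : ℝ} (hB₁ : ∀ x, |deriv salmhoferCutoff x| ≤ B₁) (hB₂ : ∀ x, |deriv (deriv salmhoferCutoff) x| ≤ B₂)
  (hB₃ : ∀ x, |deriv (deriv (deriv salmhoferCutoff)) x| ≤ B₃)
  {Nt : ℝ} (hNt0 : 0 ≤ Nt)
  (hNt : ∀ (y w : EuclideanSpace ℝ (Fin 2)), |fderiv ℝ (frameLevel μ Kb) y w - fderiv ℝ (frameLevel μ K) y w| ≤ Nt * ‖w‖)
  -- the names (instantiate with `rfl`): common, iso family, tangent family, time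
  {ρf κ C₁ B₀x ε₂ ζ t 𝔮₁ 𝔮₂ 𝔮₃₀ 𝔮₃₁ d₁ w₁ d₂ w₂ d₃₀ d₃₁ w₃₀ w₃₁ o₁₀ o₁₁ o₂₀ o₂₁ o₂₂ o₃₀ o₃₁ o₃₂ o₃₃
    R₁₀ R₁₁ R₂₀ R₂₁ R₂₂ R₃₀ R₃₁ R₃₂ R₃₃ r₁₀ r₁₁ r₂₀ r₂₁ r₂₂ r₃₀ r₃₁ r₃₂ r₃₃
    tv 𝔳₁ 𝔳₂ 𝔳₃₀ 𝔳₃₁ dv₁ wv₁ dv₂ wv₂ dv₃₀ dv₃₁ wv₃₀ wv₃₁ ov₁₀ ov₁₁ ov₂₀ ov₂₁ ov₂₂ ov₃₀ ov₃₁ ov₃₂ ov₃₃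
    Rv₁₀ Rv₁₁ Rv₂₀ Rv₂₁ Rv₂₂ Rv₃₀ Rv₃₁ Rv₃₂ Rv₃₃ rv₁₀ rv₁₁ rv₂₀ rv₂₁ rv₂₂ rv₃₀ rv₃₁ rv₃₂ rv₃₃
    qt₁ qt₂ qt₃ Dt₁ Dt₂ θ₁ θ₂ θ₃ : ℝ}
  (hρf : ρf = (klScale e₀ m + B.smax * B.Dtmin * (3 * sectorWidth (m + 1) / 4)) / (B.Dtmin - 2 * A) +
    π * Real.sqrt 2 * (1 + (4 + 2 * A) / (B.Dtmin - 2 * A)) * sectorWidth (m + 1))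
  (hκ : κ = e₀ ^ 2 / klScale e₀ m ^ 2) (hC₁ : C₁ = d * e₀ ^ 2 / klScale e₀ m ^ 2)
  (hB₀x : B₀x = C₁ * (G₀ / x ^ 2 * (2 * (klScale e₀ m + G₀ / x ^ 2) + G₀ / x ^ 2)))
  (hε₂ : ε₂ = 4 + 4 * A) (hζ : ζ = 1 + 6 * (sectorWidth (m + 1))⁻¹)
  -- iso family (`t = 4 + 2A`)
  (ht : t = 4 + 2 * A)
  (h𝔮₁ : 𝔮₁ = 2 * (d * e₀ ^ 2) * t / klScale e₀ m + 9 * (12 * Ba * ζ))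
  (h𝔮₂ : 𝔮₂ = (4 * (d * e₀ ^ 4) + 2 * (d * e₀ ^ 2)) * t ^ 2 / klScale e₀ m ^ 2 + 2 * (d * e₀ ^ 2) * (4 + 4 * A) / klScale e₀ m +
    4 * (d * e₀ ^ 2) * t / klScale e₀ m * (9 * (12 * Ba * ζ)) + 9 * ((12 * Ba + 72 * Ba ^ 2) * ζ ^ 2))
  (h𝔮₃₀ : 𝔮₃₀ = (8 * (d * e₀ ^ 6) + 12 * (d * e₀ ^ 4)) * t ^ 3 / klScale e₀ m ^ 3 + (12 * (d * e₀ ^ 4) + 6 * (d * e₀ ^ 2)) * (t * (4 + 4 * A)) / klScale e₀ m ^ 2 +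
    2 * (d * e₀ ^ 2) * ε₃₀ / klScale e₀ m +
    3 * (((4 * (d * e₀ ^ 4) + 2 * (d * e₀ ^ 2)) * t ^ 2 / klScale e₀ m ^ 2 + 2 * (d * e₀ ^ 2) * (4 + 4 * A) / klScale e₀ m) * (9 * (12 * Ba * ζ))) +
    3 * (2 * (d * e₀ ^ 2) * t / klScale e₀ m * (9 * ((12 * Ba + 72 * Ba ^ 2) * ζ ^ 2))) + 9 * ((12 * Ba + 216 * Ba ^ 2) * ζ ^ 3))
  (h𝔮₃₁ : 𝔮₃₁ = 2 * (d * e₀ ^ 2) * ε₃₁ / klScale e₀ m)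
  (hd₁ : d₁ = 4 * klScale e₀ m * t) (hw₁ : w₁ = 2 * (t * G₀ + 2 * klScale e₀ m * G₁ + G₀ * G₁)) (hd₂ : d₂ = 2 * (t ^ 2 + 2 * klScale e₀ m * ε₂))
  (hw₂ : w₂ = 2 * (ε₂ * G₀ + 2 * t * G₁ + 2 * klScale e₀ m * G₂ + G₁ ^ 2 + G₀ * G₂))
  (hd₃₀ : d₃₀ = 2 * (3 * t * ε₂ + 2 * klScale e₀ m * ε₃₀)) (hd₃₁ : d₃₁ = 4 * klScale e₀ m * ε₃₁)
  (hw₃₀ : w₃₀ = 2 * (ε₃₀ * G₀ + ε₃₁ * G₀ + 3 * ε₂ * G₁ + 3 * t * G₂ + 3 * G₁ * G₂ + G₀ * G₃)) (hw₃₁ : w₃₁ = 4 * klScale e₀ m * G₃)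
  (ho₁₀ : o₁₀ = t / klScale e₀ m) (ho₁₁ : o₁₁ = 2 * G₁ / G₀) (ho₂₀ : o₂₀ = ε₂ / klScale e₀ m + G₁ ^ 2 / (klScale e₀ m * G₀))
  (ho₂₁ : o₂₁ = 2 * t * G₁ / (klScale e₀ m * G₀)) (ho₂₂ : o₂₂ = 2 * G₂ / G₀)
  (ho₃₀ : o₃₀ = ε₃₀ / klScale e₀ m) (ho₃₁ : o₃₁ = ε₃₁ / klScale e₀ m + 3 * ε₂ * G₁ / (klScale e₀ m * G₀) + 3 * G₁ * G₂ / (klScale e₀ m * G₀))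
  (ho₃₂ : o₃₂ = 3 * t * G₂ / (klScale e₀ m * G₀)) (ho₃₃ : o₃₃ = 2 * G₃ / G₀)
  (hR₁₀ : R₁₀ = κ * (d₁ + w₁) + o₁₀) (hR₁₁ : R₁₁ = o₁₁)
  (hR₂₀ : R₂₀ = κ ^ 2 * (d₁ + w₁) ^ 2 + κ * (o₁₀ * (2 * d₁ + w₁)) + κ * (d₂ + w₂) + o₂₀) (hR₂₁ : R₂₁ = κ * (o₁₁ * (2 * d₁ + w₁)) + o₂₁)
  (hR₂₂ : R₂₂ = o₂₂)
  (hR₃₀ : R₃₀ = κ ^ 3 * (d₁ + w₁) ^ 3 + κ ^ 2 * (o₁₀ * (3 * d₁ ^ 2 + 3 * d₁ * w₁ + w₁ ^ 2)) +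
    3 * (κ ^ 2 * ((d₁ + w₁) * (d₂ + w₂)) + κ * (d₁ * o₂₀ + o₁₀ * d₂ + o₁₀ * w₂)) + κ * (d₃₀ + w₃₀) + o₃₀)
  (hR₃₁ : R₃₁ = κ ^ 2 * (o₁₁ * (3 * d₁ ^ 2 + 3 * d₁ * w₁ + w₁ ^ 2)) + 3 * (κ * (d₁ * o₂₁ + o₁₁ * d₂ + o₁₁ * w₂)) + κ * (d₃₁ + w₃₁) + o₃₁)
  (hR₃₂ : R₃₂ = 3 * (κ * (d₁ * o₂₂)) + o₃₂) (hR₃₃ : R₃₃ = o₃₃)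
  (hr₁₀ : r₁₀ = R₁₀ + 𝔮₁) (hr₁₁ : r₁₁ = R₁₁) (hr₂₀ : r₂₀ = R₂₀ + 2 * R₁₀ * 𝔮₁ + 𝔮₂) (hr₂₁ : r₂₁ = R₂₁ + 2 * R₁₁ * 𝔮₁) (hr₂₂ : r₂₂ = R₂₂)
  (hr₃₀ : r₃₀ = R₃₀ + 3 * R₂₀ * 𝔮₁ + 3 * R₁₀ * 𝔮₂ + 𝔮₃₀) (hr₃₁ : r₃₁ = R₃₁ + 3 * R₂₁ * 𝔮₁ + 3 * R₁₁ * 𝔮₂ + 𝔮₃₁)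
  (hr₃₂ : r₃₂ = R₃₂ + 3 * R₂₂ * 𝔮₁) (hr₃₃ : r₃₃ = R₃₃)
  -- tangent family (`t_v = (4+2A)/(N_r−1) + K₂√2ρ_f`)
  (htv : tv = (4 + 2 * A) / (Nr - 1) + K₂ * (Real.sqrt 2 * ρf))
  (h𝔳₁ : 𝔳₁ = 2 * (d * e₀ ^ 2) * tv / klScale e₀ m + 9 * (12 * Ba * ζ))
  (h𝔳₂ : 𝔳₂ = (4 * (d * e₀ ^ 4) + 2 * (d * e₀ ^ 2)) * tv ^ 2 / klScale e₀ m ^ 2 + 2 * (d * e₀ ^ 2) * (4 + 4 * A) / klScale e₀ m +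
    4 * (d * e₀ ^ 2) * tv / klScale e₀ m * (9 * (12 * Ba * ζ)) + 9 * ((12 * Ba + 72 * Ba ^ 2) * ζ ^ 2))
  (h𝔳₃₀ : 𝔳₃₀ = (8 * (d * e₀ ^ 6) + 12 * (d * e₀ ^ 4)) * tv ^ 3 / klScale e₀ m ^ 3 + (12 * (d * e₀ ^ 4) + 6 * (d * e₀ ^ 2)) * (tv * (4 + 4 * A)) / klScale e₀ m ^ 2 +
    2 * (d * e₀ ^ 2) * ε₃₀ / klScale e₀ m +
    3 * (((4 * (d * e₀ ^ 4) + 2 * (d * e₀ ^ 2)) * tv ^ 2 / klScale e₀ m ^ 2 + 2 * (d * e₀ ^ 2) * (4 + 4 * A) / klScale e₀ m) * (9 * (12 * Ba * ζ))) +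
    3 * (2 * (d * e₀ ^ 2) * tv / klScale e₀ m * (9 * ((12 * Ba + 72 * Ba ^ 2) * ζ ^ 2))) + 9 * ((12 * Ba + 216 * Ba ^ 2) * ζ ^ 3))
  (h𝔳₃₁ : 𝔳₃₁ = 2 * (d * e₀ ^ 2) * ε₃₁ / klScale e₀ m)
  (hdv₁ : dv₁ = 4 * klScale e₀ m * tv) (hwv₁ : wv₁ = 2 * (tv * G₀ + 2 * klScale e₀ m * G₁ + G₀ * G₁)) (hdv₂ : dv₂ = 2 * (tv ^ 2 + 2 * klScale e₀ m * ε₂))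
  (hwv₂ : wv₂ = 2 * (ε₂ * G₀ + 2 * tv * G₁ + 2 * klScale e₀ m * G₂ + G₁ ^ 2 + G₀ * G₂))
  (hdv₃₀ : dv₃₀ = 2 * (3 * tv * ε₂ + 2 * klScale e₀ m * ε₃₀)) (hdv₃₁ : dv₃₁ = 4 * klScale e₀ m * ε₃₁)
  (hwv₃₀ : wv₃₀ = 2 * (ε₃₀ * G₀ + ε₃₁ * G₀ + 3 * ε₂ * G₁ + 3 * tv * G₂ + 3 * G₁ * G₂ + G₀ * G₃)) (hwv₃₁ : wv₃₁ = 4 * klScale e₀ m * G₃)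
  (hov₁₀ : ov₁₀ = tv / klScale e₀ m) (hov₁₁ : ov₁₁ = 2 * G₁ / G₀) (hov₂₀ : ov₂₀ = ε₂ / klScale e₀ m + G₁ ^ 2 / (klScale e₀ m * G₀))
  (hov₂₁ : ov₂₁ = 2 * tv * G₁ / (klScale e₀ m * G₀)) (hov₂₂ : ov₂₂ = 2 * G₂ / G₀)
  (hov₃₀ : ov₃₀ = ε₃₀ / klScale e₀ m) (hov₃₁ : ov₃₁ = ε₃₁ / klScale e₀ m + 3 * ε₂ * G₁ / (klScale e₀ m * G₀) + 3 * G₁ * G₂ / (klScale e₀ m * G₀))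
  (hov₃₂ : ov₃₂ = 3 * tv * G₂ / (klScale e₀ m * G₀)) (hov₃₃ : ov₃₃ = 2 * G₃ / G₀)
  (hRv₁₀ : Rv₁₀ = κ * (dv₁ + wv₁) + ov₁₀) (hRv₁₁ : Rv₁₁ = ov₁₁)
  (hRv₂₀ : Rv₂₀ = κ ^ 2 * (dv₁ + wv₁) ^ 2 + κ * (ov₁₀ * (2 * dv₁ + wv₁)) + κ * (dv₂ + wv₂) + ov₂₀) (hRv₂₁ : Rv₂₁ = κ * (ov₁₁ * (2 * dv₁ + wv₁)) + ov₂₁)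
  (hRv₂₂ : Rv₂₂ = ov₂₂)
  (hRv₃₀ : Rv₃₀ = κ ^ 3 * (dv₁ + wv₁) ^ 3 + κ ^ 2 * (ov₁₀ * (3 * dv₁ ^ 2 + 3 * dv₁ * wv₁ + wv₁ ^ 2)) +
    3 * (κ ^ 2 * ((dv₁ + wv₁) * (dv₂ + wv₂)) + κ * (dv₁ * ov₂₀ + ov₁₀ * dv₂ + ov₁₀ * wv₂)) + κ * (dv₃₀ + wv₃₀) + ov₃₀)
  (hRv₃₁ : Rv₃₁ = κ ^ 2 * (ov₁₁ * (3 * dv₁ ^ 2 + 3 * dv₁ * wv₁ + wv₁ ^ 2)) + 3 * (κ * (dv₁ * ov₂₁ + ov₁₁ * dv₂ + ov₁₁ * wv₂)) + κ * (dv₃₁ + wv₃₁) + ov₃₁)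
  (hRv₃₂ : Rv₃₂ = 3 * (κ * (dv₁ * ov₂₂)) + ov₃₂) (hRv₃₃ : Rv₃₃ = ov₃₃)
  (hrv₁₀ : rv₁₀ = Rv₁₀ + 𝔳₁) (hrv₁₁ : rv₁₁ = Rv₁₁) (hrv₂₀ : rv₂₀ = Rv₂₀ + 2 * Rv₁₀ * 𝔳₁ + 𝔳₂) (hrv₂₁ : rv₂₁ = Rv₂₁ + 2 * Rv₁₁ * 𝔳₁) (hrv₂₂ : rv₂₂ = Rv₂₂)
  (hrv₃₀ : rv₃₀ = Rv₃₀ + 3 * Rv₂₀ * 𝔳₁ + 3 * Rv₁₀ * 𝔳₂ + 𝔳₃₀) (hrv₃₁ : rv₃₁ = Rv₃₁ + 3 * Rv₂₁ * 𝔳₁ + 3 * Rv₁₁ * 𝔳₂ + 𝔳₃₁)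
  (hrv₃₂ : rv₃₂ = Rv₃₂ + 3 * Rv₂₂ * 𝔳₁) (hrv₃₃ : rv₃₃ = Rv₃₃)
  -- time
  (hqt₁ : qt₁ = 2 * (d * e₀ ^ 2) * |2 * π / β| / klScale e₀ m) (hqt₂ : qt₂ = (4 * (d * e₀ ^ 4) + 2 * (d * e₀ ^ 2)) * (2 * π / β) ^ 2 / klScale e₀ m ^ 2)
  (hqt₃ : qt₃ = (8 * (d * e₀ ^ 6) + 12 * (d * e₀ ^ 4)) * |2 * π / β| ^ 3 / klScale e₀ m ^ 3)
  (hDt₁ : Dt₁ = 2 * klScale e₀ m * |2 * π / β|) (hDt₂ : Dt₂ = 2 * (2 * π / β) ^ 2)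
  (hθ₁ : θ₁ = κ * Dt₁ + qt₁) (hθ₂ : θ₂ = κ ^ 2 * Dt₁ ^ 2 + κ * Dt₂ + 2 * (κ * Dt₁) * qt₁ + qt₂)
  (hθ₃ : θ₃ = κ ^ 3 * Dt₁ ^ 3 + 3 * (κ ^ 2 * (Dt₁ * Dt₂)) + 3 * ((κ ^ 2 * Dt₁ ^ 2 + κ * Dt₂) * qt₁) + 3 * (κ * Dt₁ * qt₂) + qt₃)
  -- the slot constant dominates the tangent slot plus the transfer
  (htvb : tv + Nt ≤ bs)

include B hA hA3 hADt he hz hz1 hgap h3 hlo hhi hβ hρA hMm hd hd1 hd2 hd3 hd4 hB0 hB hK₂ hNr hLz hν hνs hx hG₀ hG₁ hG₂ hG₃ hε₃₀ hε₃₁ hN₀ hN₁ hN₂ hN₃ hGΛ hA₃x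
  hΛ hΛΛ' hKb₁ hKb₂ hKb₃ hbs hKb₁b hKb₂x hKb₃x hB₁ hB₂ hB₃ hNt0 hNt hρf hκ hC₁ hB₀x hε₂ hζ ht h𝔮₁ h𝔮₂ h𝔮₃₀ h𝔮₃₁
  hd₁ hw₁ hd₂ hw₂ hd₃₀ hd₃₁ hw₃₀ hw₃₁ ho₁₀ ho₁₁ ho₂₀ ho₂₁ ho₂₂ ho₃₀ ho₃₁ ho₃₂ ho₃₃ hR₁₀ hR₁₁ hR₂₀ hR₂₁ hR₂₂ hR₃₀ hR₃₁ hR₃₂ hR₃₃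
  hr₁₀ hr₁₁ hr₂₀ hr₂₁ hr₂₂ hr₃₀ hr₃₁ hr₃₂ hr₃₃ htv h𝔳₁ h𝔳₂ h𝔳₃₀ h𝔳₃₁
  hdv₁ hwv₁ hdv₂ hwv₂ hdv₃₀ hdv₃₁ hwv₃₀ hwv₃₁ hov₁₀ hov₁₁ hov₂₀ hov₂₁ hov₂₂ hov₃₀ hov₃₁ hov₃₂ hov₃₃ hRv₁₀ hRv₁₁ hRv₂₀ hRv₂₁ hRv₂₂ hRv₃₀ hRv₃₁ hRv₃₂ hRv₃₃
  hrv₁₀ hrv₁₁ hrv₂₀ hrv₂₁ hrv₂₂ hrv₃₀ hrv₃₁ hrv₃₂ hrv₃₃ hqt₁ hqt₂ hqt₃ hDt₁ hDt₂ hθ₁ hθ₂ hθ₃ htvb in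
set_option maxHeartbeats 4000000 in
/-- **The per-pair SECTIONAL bound for the fat increment pair against the slice band on `K_b`, rates solved** (see the module docstring; fixed-time
twin of `slicePairWt_bgmFatIncr_le`, time section count through the co-factor `F̃^K_{ω′}`). [cite: BenfattoGiulianiMastropietro2006, §2.8 (2.81), §3 (3.2)–(3.8)] -/
theorem slicePairWt_bgmFatIncr_sectional_le (ω ω' : Fin (sectorCount (m + 1))) (v : Fin 2 → ℤ) (hv : v ≠ 0)
    (hvj : ∀ j, |(v j : ℝ)| ≤ Nr + 1 / 2) (hvlen : Nr - 1 ≤ Real.sqrt ((v 0 : ℝ) ^ 2 + (v 1 : ℝ) ^ 2))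
    (hvtan : |fderiv ℝ (fun p : Fin 2 → ℝ => frameLevel μ K (WithLp.toLp 2 p)) (klFermiPoint μ K (sectorCenter (m + 1) (ω : ℕ)))
      (fun j => 2 * π / L * (v j : ℝ))| ≤ |2 * π / L| * (4 + 2 * A))
    (Gs : TorusSite 1 (2 * M) × TorusSite 2 L → ℂ)
    (hGsdef : Gs = fun q => bgmFatMultiplier L M e₀ β (nambuXiCT L μ Ko) (m + 1) ω (⟨(q.1 0).val, ZMod.val_lt (q.1 0)⟩, q.2) *
        bgmFatMultiplier L M e₀ β (nambuXiCT L μ K) (m + 1) ω' (⟨(q.1 0).val, ZMod.val_lt (q.1 0)⟩, q.2) -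
      bgmFatMultiplier L M e₀ β (nambuXiCT L μ K) (m + 1) ω (⟨(q.1 0).val, ZMod.val_lt (q.1 0)⟩, q.2) *
        bgmFatMultiplier L M e₀ β (nambuXiCT L μ K) (m + 1) ω' (⟨(q.1 0).val, ZMod.val_lt (q.1 0)⟩, q.2))
    -- lattice resolution of the band frame's curvature
    (hLe : Kb₂ * (2 * π / L) ≤ bs) (hLv : Kb₂ * ‖(WithLp.toLp 2 (fun j => 2 * π / L * (v j : ℝ)) : EuclideanSpace ℝ (Fin 2))‖ ≤ bs)
    -- rates (`s₀ > 0` free), coefficients, thresholds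
    {s₀ ρ ρ₃ k₁ k₂ k₃ : ℝ} (hs₀ : 0 < s₀) (hρ : 0 < ρ) (hρ₃ : 0 < ρ₃)
    (hk₁ : k₁ = (16 * B₁ + 16) / Λ ^ 2) (hk₂ : k₂ = (32 * B₂ + 144 * B₁ + 128) / Λ ^ 3) (hk₃ : k₃ = (64 * B₃ + 480 * B₂ + 1728 * B₁ + 1536) / Λ ^ 4)
    {C₀ C₁' C₂ C₃ Cv₀ Cv₁ Cv₂ Cv₃ Cw₀ Cw₁ Cw₂ Kc Kw : ℝ}
    (hC₀ : C₀ = 343 * k₃ * (β * (L : ℝ) ^ 2) * bs ^ 3 + 21 * k₂ * (β * (L : ℝ) ^ 2) * bs * b₂ + k₁ * (β * (L : ℝ) ^ 2) * b₃ +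
      3 * r₁₀ * (36 * k₂ * (β * (L : ℝ) ^ 2) * bs ^ 2 + k₁ * (β * (L : ℝ) ^ 2) * b₂) + 15 * r₂₀ * k₁ * (β * (L : ℝ) ^ 2) * bs + r₃₀ * (4 * (β * (L : ℝ) ^ 2) / Λ))
    (hC₁' : C₁' = 21 * k₂ * (β * (L : ℝ) ^ 2) * bs * b₂' + k₁ * (β * (L : ℝ) ^ 2) * b₃' + 3 * r₁₁ * (36 * k₂ * (β * (L : ℝ) ^ 2) * bs ^ 2 + k₁ * (β * (L : ℝ) ^ 2) * b₂) +
      3 * r₁₀ * (k₁ * (β * (L : ℝ) ^ 2) * b₂') + 15 * r₂₁ * k₁ * (β * (L : ℝ) ^ 2) * bs + r₃₁ * (4 * (β * (L : ℝ) ^ 2) / Λ))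
    (hC₂ : C₂ = 3 * r₁₁ * (k₁ * (β * (L : ℝ) ^ 2) * b₂') + 15 * r₂₂ * k₁ * (β * (L : ℝ) ^ 2) * bs + r₃₂ * (4 * (β * (L : ℝ) ^ 2) / Λ))
    (hC₃ : C₃ = r₃₃ * (4 * (β * (L : ℝ) ^ 2) / Λ))
    (hCv₀ : Cv₀ = 343 * k₃ * (β * (L : ℝ) ^ 2) * bs ^ 3 + 21 * k₂ * (β * (L : ℝ) ^ 2) * bs * b₂ + k₁ * (β * (L : ℝ) ^ 2) * b₃ +
      3 * rv₁₀ * (36 * k₂ * (β * (L : ℝ) ^ 2) * bs ^ 2 + k₁ * (β * (L : ℝ) ^ 2) * b₂) + 15 * rv₂₀ * k₁ * (β * (L : ℝ) ^ 2) * bs + rv₃₀ * (4 * (β * (L : ℝ) ^ 2) / Λ))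
    (hCv₁ : Cv₁ = 21 * k₂ * (β * (L : ℝ) ^ 2) * bs * b₂' + k₁ * (β * (L : ℝ) ^ 2) * b₃' + 3 * rv₁₁ * (36 * k₂ * (β * (L : ℝ) ^ 2) * bs ^ 2 + k₁ * (β * (L : ℝ) ^ 2) * b₂) +
      3 * rv₁₀ * (k₁ * (β * (L : ℝ) ^ 2) * b₂') + 15 * rv₂₁ * k₁ * (β * (L : ℝ) ^ 2) * bs + rv₃₁ * (4 * (β * (L : ℝ) ^ 2) / Λ))
    (hCv₂ : Cv₂ = 3 * rv₁₁ * (k₁ * (β * (L : ℝ) ^ 2) * b₂') + 15 * rv₂₂ * k₁ * (β * (L : ℝ) ^ 2) * bs + rv₃₂ * (4 * (β * (L : ℝ) ^ 2) / Λ))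
    (hCv₃ : Cv₃ = rv₃₃ * (4 * (β * (L : ℝ) ^ 2) / Λ))
    (hCw₀ : Cw₀ = 25 * k₂ * (β * (L : ℝ) ^ 2) * bs ^ 2 + k₁ * (β * (L : ℝ) ^ 2) * b₂ + 8 * rv₁₀ * k₁ * (β * (L : ℝ) ^ 2) * bs + rv₂₀ * (4 * (β * (L : ℝ) ^ 2) / Λ))
    (hCw₁ : Cw₁ = k₁ * (β * (L : ℝ) ^ 2) * b₂' + 8 * rv₁₁ * k₁ * (β * (L : ℝ) ^ 2) * bs + rv₂₁ * (4 * (β * (L : ℝ) ^ 2) / Λ))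
    (hCw₂ : Cw₂ = rv₂₂ * (4 * (β * (L : ℝ) ^ 2) / Λ))
    (hKc : Kc = 32 * (β * (L : ℝ) ^ 2) / (π ^ 3 * Λ)) (hKw : Kw = 16 * (β * (L : ℝ) ^ 2) / (π ^ 2 * Λ))
    (th₃ : 4 * C₃ * ρ ^ 3 ≤ Kc) (th₂ : 4 * C₂ * ρ ^ 3 ≤ Kc * x) (th₁ : 4 * C₁' * ρ ^ 3 ≤ Kc * x ^ 2) (th₀ : 4 * C₀ * ρ ^ 3 ≤ Kc * x ^ 3)
    (tv₃ : 4 * Cv₃ * ρ ^ 3 ≤ Kc) (tv₂ : 4 * Cv₂ * ρ ^ 3 ≤ Kc * x) (tv₁ : 4 * Cv₁ * ρ ^ 3 ≤ Kc * x ^ 2) (tv₀ : 4 * Cv₀ * ρ ^ 3 ≤ Kc * x ^ 3)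
    (tw₂ : 3 * Cw₂ * ρ₃ ^ 2 ≤ Kw) (tw₁ : 3 * Cw₁ * ρ₃ ^ 2 ≤ Kw * x) (tw₀ : 3 * Cw₀ * ρ₃ ^ 2 ≤ Kw * x ^ 2) :
    ∀ z₁ : TorusSite 1 (2 * M), ∑ z₂ : TorusSite 2 L,
        (1 + ρ / x * |(((z₂ 0).valMinAbs : ℤ) : ℝ)| + ρ / x * |(((z₂ 1).valMinAbs : ℤ) : ℝ)|) *
        ‖∑ q : TorusSite 1 (2 * M) × TorusSite 2 L, (torusChar q.1 z₁ * torusChar q.2 z₂) •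
          ((((1 / (β * (L : ℝ) ^ 2) : ℝ) : ℂ) ^ 2 *
            (Gs q * sliceSymbolFnXi (β * (L : ℝ) ^ 2) 0 Λ Λ' (matsubaraFreq β M ⟨(q.1 0).val, ZMod.val_lt (q.1 0)⟩) (nambuXiCT L μ Kb q.2))))‖ ≤
      (klScale e₀ m * β / π + 3) *
        (x * Real.sqrt (524288 * (1 / s₀ + 1) * ((1 + 4 * Real.sqrt 2) ^ 2 * ((2 * Real.sqrt 2 / ρ + 2) * (2 * Real.sqrt 2 / ρ₃ + 2)) + (1 / ρ + 1) ^ 2)) *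
          Real.sqrt (24 * (L : ℝ) ^ 2 *
            ((Real.sqrt 2 * L * ((klScale e₀ m + (4 + 4 * A) * ρf ^ 2) / (2 * B.rhomin - 4 * A)) / π + 2) *
              (Real.sqrt 2 * L * (2 * ρf) / π + 2))) *
          (B₀x * ((1 / (β * (L : ℝ) ^ 2)) ^ 2 * (4 * (β * (L : ℝ) ^ 2) / Λ)))) := by
  have hL : (0 : ℝ) < L := Nat.cast_pos.2 (Nat.pos_of_ne_zero (NeZero.ne L))
  have hπ := Real.pi_pos
  have hΛm : 0 < klScale e₀ m := by rw [klScale]; positivity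
  have hA0 : 0 ≤ A := (norm_nonneg _).trans (hA 0 0 (by norm_num))
  have hx0 : 0 < x := lt_of_lt_of_le one_pos hx
  have hK20 : 0 ≤ K₂ := (norm_nonneg _).trans (hK₂ 0)
  have hNr1 : 0 < Nr - 1 := by linarith only [hNr]
  have hDt : 0 < B.Dtmin - 2 * A := by linarith only [hADt]
  have hρf0 : 0 ≤ ρf := by rw [hρf]; have := B.smax_pos; have := B.Dtmin_pos; have := sectorWidth_pos (m + 1); positivity
  have hB₀x0 : 0 ≤ B₀x := by rw [hB₀x, hC₁]; positivity
  -- amplitude, support, tangency, time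
  obtain ⟨hsup, -, hτE, -, -, -, -, -, -⟩ := bgmFatIncrPair_ampTime_data B Ko hA hADt he hz hz1 hgap h3 hlo hhi hβ hρA m hMm hd hd1 hd2 hd3 hd4 hK₂ hν hx
    hN₀ hρf hκ hC₁ hB₀x hqt₁ hqt₂ hqt₃ hDt₁ hDt₂ hθ₁ hθ₂ hθ₃ ω ω' v hvtan Gs hGsdef
  -- the degenerate amplitude
  rcases hB₀x0.eq_or_lt with hzero | hpos
  · have hGs0 : ∀ q, Gs q = 0 := fun q => norm_le_zero_iff.1 ((hsup q).trans_eq hzero.symm)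
    have hin : ∀ (z₁ : TorusSite 1 (2 * M)) (z₂ : TorusSite 2 L), (∑ q : TorusSite 1 (2 * M) × TorusSite 2 L,
        (torusChar q.1 z₁ * torusChar q.2 z₂) •
        ((((1 / (β * (L : ℝ) ^ 2) : ℝ) : ℂ) ^ 2 *
          (Gs q * sliceSymbolFnXi (β * (L : ℝ) ^ 2) 0 Λ Λ' (matsubaraFreq β M ⟨(q.1 0).val, ZMod.val_lt (q.1 0)⟩) (nambuXiCT L μ Kb q.2))))) = 0 :=
      fun z₁ z₂ => Finset.sum_eq_zero fun q _ => by rw [hGs0 q, zero_mul, mul_zero, smul_zero]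
    intro z₁
    simp_rw [hin, norm_zero, mul_zero, Finset.sum_const_zero]
    rw [← hzero]; simp
  -- space data: axes and normal from the iso file, tangent from the tangent file
  have hue : ∀ i : Fin 2, ∀ j, 3 * |2 * π / L| * |(((Pi.single i (1 : ℤ) : Fin 2 → ℤ) j : ℤ) : ℝ)| ≤ z := by
    intro i j
    have h1 : |(((Pi.single i (1 : ℤ) : Fin 2 → ℤ) j : ℤ) : ℝ)| ≤ Nr + 1 / 2 := by
      have : |(((Pi.single i (1 : ℤ) : Fin 2 → ℤ) j : ℤ) : ℝ)| ≤ 1 := by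
        by_cases h : j = i
        · subst h; simp
        · simp [h]
      linarith only [this, hNr]
    exact (mul_le_mul_of_nonneg_left h1 (by positivity)).trans hLz
  have hun : ∀ j, 3 * |2 * π / L| * |(((![-v 1, v 0] : Fin 2 → ℤ) j : ℤ) : ℝ)| ≤ z := by
    intro j
    have h1 : |(((![-v 1, v 0] : Fin 2 → ℤ) j : ℤ) : ℝ)| ≤ Nr + 1 / 2 := by
      fin_cases j
      · show |(((-v 1 : ℤ) : ℤ) : ℝ)| ≤ Nr + 1 / 2
        rw [Int.cast_neg, abs_neg]; exact hvj 1
      · exact hvj 0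
    exact (mul_le_mul_of_nonneg_left h1 (by positivity)).trans hLz
  have hstep : ∀ i : Fin 2, (fun j => ((((Pi.single i (1 : ℤ) : Fin 2 → ℤ) j : ℤ) : ZMod L))) = (Pi.single i (1 : ZMod L) : TorusSite 2 L) := by
    intro i; funext j
    by_cases h : j = i
    · subst h; simp
    · simp [h]
  have hiso := fun (u : Fin 2 → ℤ) (hu : ∀ j, 3 * |2 * π / L| * |(u j : ℝ)| ≤ z) (q : TorusSite 1 (2 * M) × TorusSite 2 L) =>
    norm_fwdDiff_iter_fatIncrPair_scaleIso_le Ko hA hA3 he hz hz1 hgap h3 m hd1 hd2 hd3 hd4 hB0 hB hν hνs hx hG₀ hG₁ hG₂ hG₃ hε₃₀ hε₃₁ hN₀ hN₁ hN₂ hN₃ hGΛ hA₃x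
      hκ hC₁ hB₀x ht hε₂ hζ h𝔮₁ h𝔮₂ h𝔮₃₀ h𝔮₃₁ hd₁ hw₁ hd₂ hw₂ hd₃₀ hd₃₁ hw₃₀ hw₃₁ ho₁₀ ho₁₁ ho₂₀ ho₂₁ ho₂₂ ho₃₀ ho₃₁ ho₃₂ ho₃₃
      hR₁₀ hR₁₁ hR₂₀ hR₂₁ hR₂₂ hR₃₀ hR₃₁ hR₃₂ hR₃₃ hr₁₀ hr₁₁ hr₂₀ hr₂₁ hr₂₂ hr₃₀ hr₃₁ hr₃₂ hr₃₃ ω ω' Gs hGsdef u hu q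
  have htan := fun (q : TorusSite 1 (2 * M) × TorusSite 2 L) =>
    norm_fwdDiff_iter_fatIncrPair_scaleTan_le B Ko hA hA3 hADt he hz hz1 hgap h3 hlo hhi m hK₂ hNr hLz hd1 hd2 hd3 hd4 hB0 hB hν hνs hx hG₀ hG₁ hG₂ hG₃ hε₃₀ hε₃₁
      hN₀ hN₁ hN₂ hN₃ hGΛ hA₃x hρf hκ hC₁ hB₀x htv hε₂ hζ h𝔳₁ h𝔳₂ h𝔳₃₀ h𝔳₃₁ hdv₁ hwv₁ hdv₂ hwv₂ hdv₃₀ hdv₃₁ hwv₃₀ hwv₃₁ hov₁₀ hov₁₁ hov₂₀ hov₂₁ hov₂₂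
      hov₃₀ hov₃₁ hov₃₂ hov₃₃ hRv₁₀ hRv₁₁ hRv₂₀ hRv₂₁ hRv₂₂ hRv₃₀ hRv₃₁ hRv₃₂ hRv₃₃ hrv₁₀ hrv₁₁ hrv₂₀ hrv₂₁ hrv₂₂ hrv₃₀ hrv₃₁ hrv₃₂ hrv₃₃ ω ω' Gs hGsdef v
      hvj hvlen hvtan q
  obtain ⟨-, -, -, hrnn⟩ := hiso (Pi.single 0 1) (hue 0) 0
  obtain ⟨-, -, -, hrvnn⟩ := htan 0
  -- the tangency datum of the band frame on the support
  set ηv : ℝ := ‖(WithLp.toLp 2 (fun j => 2 * π / L * (v j : ℝ)) : EuclideanSpace ℝ (Fin 2))‖ with hηv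
  have hηNr : 2 * π / L * (Nr - 1) ≤ ηv := by
    rw [hηv, norm_toLp_latticeStep]; exact mul_le_mul_of_nonneg_left hvlen (by positivity)
  have hτ0 : 0 ≤ (tv + Nt) * ηv := by rw [htv]; positivity
  have hτ : ∀ q, Gs q ≠ 0 → |fderiv ℝ (frameLevel μ Kb) (WithLp.toLp 2 (torusCentredMomentum L q.2))
      (WithLp.toLp 2 (fun i => 2 * π / L * (v i : ℝ)))| ≤ (tv + Nt) * ηv := by
    intro q hq
    have h1 := hτE q hq
    have h2 := hNt (WithLp.toLp 2 (torusCentredMomentum L q.2)) (WithLp.toLp 2 (fun i => 2 * π / L * (v i : ℝ)))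
    have h3 := abs_sub_abs_le_abs_sub (fderiv ℝ (frameLevel μ Kb) (WithLp.toLp 2 (torusCentredMomentum L q.2)) (WithLp.toLp 2 (fun i => 2 * π / L * (v i : ℝ))))
      (fderiv ℝ (frameLevel μ K) (WithLp.toLp 2 (torusCentredMomentum L q.2)) (WithLp.toLp 2 (fun i => 2 * π / L * (v i : ℝ))))
    have h4 : |2 * π / L| * (4 + 2 * A) ≤ (4 + 2 * A) / (Nr - 1) * ηv := by
      rw [abs_of_pos (by positivity : (0:ℝ) < 2 * π / L)]
      have h := mul_le_mul_of_nonneg_left hηNr (by positivity : (0:ℝ) ≤ (4 + 2 * A) / (Nr - 1))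
      have e : (4 + 2 * A) / (Nr - 1) * (2 * π / L * (Nr - 1)) = 2 * π / L * (4 + 2 * A) := by field_simp
      linarith only [h, e]
    have e : (tv + Nt) * ηv = (4 + 2 * A) / (Nr - 1) * ηv + K₂ * (Real.sqrt 2 * ρf) * ηv + Nt * ηv := by rw [htv]; ring
    rw [e]; linarith only [h1, h2, h3, h4]
  have hτb : (tv + Nt) * ηv ≤ bs * ηv := mul_le_mul_of_nonneg_right htvb (norm_nonneg _)
  -- the two section counts of the increment pair (through the co-factor `F̃^K_{ω′}`)
  have hsuppT : (((univ : Finset (TorusSite 1 (2 * M))).filter fun q₁ => ∃ k : TorusSite 2 L, Gs (q₁, k) ≠ 0).card : ℝ) ≤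
      klScale e₀ m * β / π + 3 := by
    refine le_trans ?_ (card_timeSections_bgmFat_le (L := L) (M := M) (μ := μ) he hβ K m ω')
    exact_mod_cast Finset.card_le_card fun q₁ hq₁ => by
      rw [mem_filter] at hq₁ ⊢
      obtain ⟨k, hk⟩ := hq₁.2
      exact ⟨mem_univ _, k, fun h0 => hk (by rw [hGsdef]; dsimp only; rw [h0, mul_zero, mul_zero, sub_self])⟩
  have hsuppS : ∀ q₁ : TorusSite 1 (2 * M), (((univ : Finset (TorusSite 2 L)).filter fun k => Gs (q₁, k) ≠ 0).card : ℝ) ≤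
      (Real.sqrt 2 * L * ((klScale e₀ m + (4 + 4 * A) * ρf ^ 2) / (2 * B.rhomin - 4 * A)) / π + 2) *
        (Real.sqrt 2 * L * (2 * ρf) / π + 2) := by
    intro q₁
    have h := card_spaceSection_bgmFat_le (L := L) (M := M) (β := β) B hA hADt he hz hz1 hgap hlo hhi hρA m ω' ⟨(q₁ 0).val, ZMod.val_lt (q₁ 0)⟩
    rw [← hρf] at h
    refine le_trans ?_ h
    exact_mod_cast Finset.card_le_card fun k hk => by
      rw [mem_filter] at hk ⊢
      exact ⟨mem_univ _, fun h0 => hk.2 (by rw [hGsdef]; dsimp only; rw [h0, mul_zero, mul_zero, sub_self])⟩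
  obtain ⟨Nt, hNt, hNtle⟩ : ∃ Nt : ℕ, ((univ : Finset (TorusSite 1 (2 * M))).filter fun q₁ => ∃ k : TorusSite 2 L, Gs (q₁, k) ≠ 0).card ≤ Nt ∧
      (Nt : ℝ) ≤ klScale e₀ m * β / π + 3 := ⟨_, le_rfl, hsuppT⟩
  obtain ⟨Nsp, hNsp, hNsple⟩ : ∃ Nsp : ℕ, (∀ q₁ : TorusSite 1 (2 * M), ((univ : Finset (TorusSite 2 L)).filter fun k => Gs (q₁, k) ≠ 0).card ≤ Nsp) ∧
      (Nsp : ℝ) ≤ (Real.sqrt 2 * L * ((klScale e₀ m + (4 + 4 * A) * ρf ^ 2) / (2 * B.rhomin - 4 * A)) / π + 2) *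
        (Real.sqrt 2 * L * (2 * ρf) / π + 2) := by
    refine ⟨univ.sup fun q₁ : TorusSite 1 (2 * M) => ((univ : Finset (TorusSite 2 L)).filter fun k => Gs (q₁, k) ≠ 0).card,
      fun q₁ => le_sup (f := fun q₁ : TorusSite 1 (2 * M) => ((univ : Finset (TorusSite 2 L)).filter fun k => Gs (q₁, k) ≠ 0).card) (mem_univ q₁), ?_⟩
    obtain ⟨q₁, -, hq₁⟩ := exists_mem_eq_sup (univ : Finset (TorusSite 1 (2 * M))) univ_nonempty
      (fun q₁ : TorusSite 1 (2 * M) => ((univ : Finset (TorusSite 2 L)).filter fun k => Gs (q₁, k) ≠ 0).card)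
    rw [hq₁]; exact hsuppS q₁
  -- the sectional pair lemma in the family-increment scale class
  have main := slicePairWt_charSum_sectional_le_famIncrScale (K := Kb) hβ hΛ hΛΛ' hx hbs hKb₁ hKb₂ hKb₃ hKb₁b hKb₂x hKb₃x hB₁ hB₂ hB₃ Gs hpos hsup
    hNt hNsp v hv hrnn hrvnn
    (fun q i => by have h := (hiso (Pi.single i 1) (hue i) q).1; rwa [hstep i] at h)
    (fun q i => by have h := (hiso (Pi.single i 1) (hue i) q).2.1; rwa [hstep i] at h)
    (fun q i => by have h := (hiso (Pi.single i 1) (hue i) q).2.2.1; rwa [hstep i] at h)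
    (fun q => (hiso _ hun q).1) (fun q => (hiso _ hun q).2.1) (fun q => (hiso _ hun q).2.2.1)
    (fun q => (htan q).1) (fun q => (htan q).2.1) (fun q => (htan q).2.2.1)
    hτ0 hτ hτb hLe hLv hs₀ hρ hρ₃ hk₁ hk₂ hk₃ hC₀ hC₁' hC₂ hC₃ hCv₀ hCv₁ hCv₂ hCv₃ hCw₀ hCw₁ hCw₂ hKc hKw th₃ th₂ th₁ th₀ tv₃ tv₂ tv₁ tv₀ tw₂ tw₁ tw₀
  intro z₁
  refine (main z₁).trans ?_
  have hrad0 : 0 ≤ 24 * (L : ℝ) ^ 2 := by positivity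
  have hcardR : 24 * (L : ℝ) ^ 2 * (Nsp : ℝ) ≤
      24 * (L : ℝ) ^ 2 * ((Real.sqrt 2 * L * ((klScale e₀ m + (4 + 4 * A) * ρf ^ 2) / (2 * B.rhomin - 4 * A)) / π + 2) *
        (Real.sqrt 2 * L * (2 * ρf) / π + 2)) := mul_le_mul_of_nonneg_left hNsple hrad0
  have hA₀ : 0 ≤ B₀x * ((1 / (β * (L : ℝ) ^ 2)) ^ 2 * (4 * (β * (L : ℝ) ^ 2) / Λ)) := by positivity
  have hin0 : 0 ≤ x * Real.sqrt (524288 * (1 / s₀ + 1) * ((1 + 4 * Real.sqrt 2) ^ 2 * ((2 * Real.sqrt 2 / ρ + 2) * (2 * Real.sqrt 2 / ρ₃ + 2)) +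
      (1 / ρ + 1) ^ 2)) * Real.sqrt (24 * (L : ℝ) ^ 2 * ((Real.sqrt 2 * L * ((klScale e₀ m + (4 + 4 * A) * ρf ^ 2) / (2 * B.rhomin - 4 * A)) / π + 2) *
        (Real.sqrt 2 * L * (2 * ρf) / π + 2))) * (B₀x * ((1 / (β * (L : ℝ) ^ 2)) ^ 2 * (4 * (β * (L : ℝ) ^ 2) / Λ))) := by positivity
  calc (Nt : ℝ) * (x * Real.sqrt (524288 * (1 / s₀ + 1) * ((1 + 4 * Real.sqrt 2) ^ 2 * ((2 * Real.sqrt 2 / ρ + 2) * (2 * Real.sqrt 2 / ρ₃ + 2)) +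
          (1 / ρ + 1) ^ 2)) * Real.sqrt (24 * (L : ℝ) ^ 2 * Nsp) * (B₀x * ((1 / (β * (L : ℝ) ^ 2)) ^ 2 * (4 * (β * (L : ℝ) ^ 2) / Λ))))
      ≤ (Nt : ℝ) * (x * Real.sqrt (524288 * (1 / s₀ + 1) * ((1 + 4 * Real.sqrt 2) ^ 2 * ((2 * Real.sqrt 2 / ρ + 2) * (2 * Real.sqrt 2 / ρ₃ + 2)) +
          (1 / ρ + 1) ^ 2)) * Real.sqrt (24 * (L : ℝ) ^ 2 * ((Real.sqrt 2 * L * ((klScale e₀ m + (4 + 4 * A) * ρf ^ 2) / (2 * B.rhomin - 4 * A)) / π + 2) *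
            (Real.sqrt 2 * L * (2 * ρf) / π + 2))) * (B₀x * ((1 / (β * (L : ℝ) ^ 2)) ^ 2 * (4 * (β * (L : ℝ) ^ 2) / Λ)))) := by
        gcongr
    _ ≤ _ := mul_le_mul_of_nonneg_right hNtle hin0

end PairBound

end Summit.HubbardSuperconductivity.HubbardSuperconductivity.Theorems.TorusFourierL2

end
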